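import Summits.FinalStateConjecture.FinalStateConjecture.Theorems.EIHFluxBalanceInertialRecessionStubEndgameOracleTight
import Summits.FinalStateConjecture.FinalStateConjecture.Theorems.EIHFluxBalanceInertialRecessionStubEndgameBallistic
import Summits.FinalStateConjecture.FinalStateConjecture.Theorems.EIHFluxBalanceInertialRecessionStubEndgameToyBasics

/-!
# Route EIHFluxBalance — crux `InertialRecession`, line `sublinear-is-free-clean-window-charges`:
# the increment oracle for TIGHT member sets with BALLISTIC outsiders (the explicit radius and its integral)

Helper file for the crux `stmt-FinalStateConjecture-10166`
(`Summit.FinalStateConjecture.FinalStateConjecture.Theses.EIHFluxBalance.InertialRecession`), registered stub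
`stub_pairwiseDichotomy` (lead reshape r7) of `Cruxes/InertialRecession/Lines/sublinear_is_free_clean_window_charges.lean`;
continues `…OracleTight`.

For a member set `A ∋ a` with nonempty complement the natural radius is `R(s) = min(c₀s, (2/3)·D(s))`, `D(s) = min_{j∉A}‖ξⱼ(s) − ξₐ(s)‖`,
`c₀ = (κ−κ²)/2`: non-members are automatically beyond `3R/2`, `R` is 2-Lipschitz when the centres move at speed `≤ 3/2`
(`abs_inf'_sub_inf'_le`), and the window-law integrand obeys `R^{-3/2} ≤ (c₀s)^{-3/2} + 2·Σ_{j∉A} ‖ξⱼ − ξₐ‖^{-3/2}`. When every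
(reference, outsider) pair is BALLISTIC on `[t₁,t₂]` — a fixed unit direction `n` with `⟪ξ̇ⱼ − ξ̇ₐ, n⟫ ≥ W/2` — and all distances are
`≥ A₀`, each outsider term integrates to `≤ 2√2·8/(W√A₀)` (`integral_ballistic_le` on `x = ⟪ξⱼ − ξₐ, n⟫`), so
`∫R^{-3/2} ≤ 2c₀^{-3/2}t₁^{-1/2} + 2·|Aᶜ|·2√2·8/(W√A₀)` (`integral_radius_le`). Combined with `increment_of_windowPath` this is the
increment ORACLE for TIGHT member sets (`tight_increment`): the members must stay within `R/2` of the reference on the interval.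
-/

noncomputable section

set_option linter.dupNamespace false

open Filter Topology Set MeasureTheory intervalIntegral
open scoped Topology BigOperators InnerProductSpace RealInnerProductSpace

namespace Summit.FinalStateConjecture.FinalStateConjecture.Theorems.SublinearIsFree.Oracle

open Literature.Geometry.Lorentzian
open Summit.FinalStateConjecture.FinalStateConjecture.Theorems.SublinearIsFree.Endgame
open Summit.FinalStateConjecture.FinalStateConjecture.Theorems.SublinearIsFree.Toy

/-! ### Lipschitz minima -/

/-- The minimum over a nonempty finite family of `L`-Lipschitz functions is `L`-Lipschitz (two-point form). [folklore] -/
theorem abs_inf'_sub_inf'_le {ι : Type*} (S : Finset ι) (hS : S.Nonempty) (f : ι → ℝ → ℝ) {L s s' : ℝ}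
    (h : ∀ j ∈ S, |f j s - f j s'| ≤ L * |s - s'|) :
    |S.inf' hS (fun j ↦ f j s) - S.inf' hS (fun j ↦ f j s')| ≤ L * |s - s'| := by
  rw [abs_le]
  constructor
  · -- lower bound: use the minimiser at `s`
    obtain ⟨j, hj, hjmin⟩ := Finset.exists_mem_eq_inf' hS (fun j ↦ f j s)
    have h1 : S.inf' hS (fun j ↦ f j s') ≤ f j s' := Finset.inf'_le _ hj
    have h2 := h j hj
    rw [abs_le] at h2
    rw [hjmin]; linarith [h2.1]
  · obtain ⟨j, hj, hjmin⟩ := Finset.exists_mem_eq_inf' hS (fun j ↦ f j s')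
    have h1 : S.inf' hS (fun j ↦ f j s) ≤ f j s := Finset.inf'_le _ hj
    have h2 := h j hj
    rw [abs_le] at h2
    rw [hjmin]; linarith [h2.2]

/-- Distances between centres moving at speed `≤ 3/4` after `T₀` change at rate `≤ 3/2`: two-point Lipschitz bound. [folklore] -/
theorem abs_norm_sub_sub_norm_sub_le {ξ₁ ξ₂ : ℝ → E3} (h₁ : Differentiable ℝ ξ₁) (h₂ : Differentiable ℝ ξ₂) {T₀ : ℝ}
    (hb₁ : ∀ t, T₀ ≤ t → ‖deriv ξ₁ t‖ ≤ 3 / 4) (hb₂ : ∀ t, T₀ ≤ t → ‖deriv ξ₂ t‖ ≤ 3 / 4)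
    {s s' : ℝ} (hs : T₀ ≤ s) (hs' : T₀ ≤ s') :
    |‖ξ₁ s - ξ₂ s‖ - ‖ξ₁ s' - ξ₂ s'‖| ≤ (3 / 2) * |s - s'| := by
  have hd : Differentiable ℝ (fun t ↦ ξ₁ t - ξ₂ t) := h₁.sub h₂
  have hb : ∀ t, T₀ ≤ t → ‖deriv (fun t ↦ ξ₁ t - ξ₂ t) t‖ ≤ 3 / 2 := by
    intro t ht
    have hder : deriv (fun t ↦ ξ₁ t - ξ₂ t) t = deriv ξ₁ t - deriv ξ₂ t :=
      ((h₁ t).hasDerivAt.sub (h₂ t).hasDerivAt).deriv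
    rw [hder]
    calc ‖deriv ξ₁ t - deriv ξ₂ t‖ ≤ ‖deriv ξ₁ t‖ + ‖deriv ξ₂ t‖ := norm_sub_le _ _
      _ ≤ 3 / 2 := by linarith [hb₁ t ht, hb₂ t ht]
  have hconv : Convex ℝ (Ici T₀) := convex_Ici T₀
  have h := hconv.norm_image_sub_le_of_norm_deriv_le (f := fun t ↦ ξ₁ t - ξ₂ t) (fun x _ ↦ hd.differentiableAt)
    (fun x hx ↦ hb x hx) hs' hs
  calc |‖ξ₁ s - ξ₂ s‖ - ‖ξ₁ s' - ξ₂ s'‖| ≤ ‖(ξ₁ s - ξ₂ s) - (ξ₁ s' - ξ₂ s')‖ := abs_norm_sub_norm_le _ _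
    _ ≤ 3 / 2 * ‖s - s'‖ := h
    _ = 3 / 2 * |s - s'| := by rw [Real.norm_eq_abs]

/-! ### The ballistic majorant in `E3` -/

/-- **BALLISTIC MAJORANT (inner-product form).** If on `[t₁,t₂]` the relative coordinate `x = ⟪ξⱼ − ξₐ, n⟫` (`‖n‖ = 1`) has
derivative `≥ W/2 > 0` and the distance is `≥ A₀ > 0`, then `‖ξⱼ − ξₐ‖^{-3/2} = (d√d)⁻¹` is majorised by the continuous
`2√2((|x|+A₀)√(|x|+A₀))⁻¹`, whose integral is `≤ 2√2·8/(W√A₀)`. [folklore] -/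
theorem ballistic_majorant_inner {ξa ξj : ℝ → E3} (ha : ContDiff ℝ 1 ξa) (hj : ContDiff ℝ 1 ξj) {n : E3} (hn : ‖n‖ = 1)
    {t₁ t₂ W A₀ : ℝ} (h12 : t₁ ≤ t₂) (hW : 0 < W) (hA₀ : 0 < A₀)
    (hspeed : ∀ s ∈ Icc t₁ t₂, W / 2 ≤ ⟪deriv ξj s - deriv ξa s, n⟫)
    (hfar : ∀ s ∈ Icc t₁ t₂, A₀ ≤ ‖ξj s - ξa s‖) :
    (∀ s ∈ Icc t₁ t₂, (‖ξj s - ξa s‖ * √‖ξj s - ξa s‖)⁻¹ ≤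
        2 * √2 * ((|⟪ξj s - ξa s, n⟫| + A₀) * √(|⟪ξj s - ξa s, n⟫| + A₀))⁻¹) ∧
    ContinuousOn (fun s ↦ 2 * √2 * ((|⟪ξj s - ξa s, n⟫| + A₀) * √(|⟪ξj s - ξa s, n⟫| + A₀))⁻¹) (Icc t₁ t₂) ∧
    ∫ s in t₁..t₂, 2 * √2 * ((|⟪ξj s - ξa s, n⟫| + A₀) * √(|⟪ξj s - ξa s, n⟫| + A₀))⁻¹ ≤ 2 * √2 * (8 / (W * √A₀)) := by
  set x : ℝ → ℝ := fun s ↦ ⟪ξj s - ξa s, n⟫ with hx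
  set x' : ℝ → ℝ := fun s ↦ ⟪deriv ξj s - deriv ξa s, n⟫ with hx'
  have hdj : Differentiable ℝ ξj := hj.differentiable one_ne_zero
  have hda : Differentiable ℝ ξa := ha.differentiable one_ne_zero
  have hxd : ∀ s, HasDerivAt x (x' s) s := fun s ↦ by
    have h := HasDerivAt.inner ℝ (((hdj s).hasDerivAt).sub ((hda s).hasDerivAt)) (hasDerivAt_const s n)
    simpa [hx, hx'] using h
  have hx'c : Continuous x' := ((hj.continuous_deriv le_rfl).sub (ha.continuous_deriv le_rfl)).inner continuous_const
  have hxc : Continuous x := (hdj.continuous.sub hda.continuous).inner continuous_const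
  have hq : ∀ s, 0 < |x s| + A₀ := fun s ↦ by positivity
  have hψc : Continuous fun s ↦ 2 * √2 * ((|x s| + A₀) * √(|x s| + A₀))⁻¹ := by
    have hc : Continuous fun s ↦ |x s| + A₀ := hxc.abs.add continuous_const
    refine continuous_const.mul ((hc.mul hc.sqrt).inv₀ fun s ↦ ?_)
    exact (mul_pos (hq s) (Real.sqrt_pos.mpr (hq s))).ne'
  refine ⟨fun s hs ↦ ?_, hψc.continuousOn, ?_⟩
  · have h1 : |x s| ≤ ‖ξj s - ξa s‖ := by
      calc |x s| ≤ ‖ξj s - ξa s‖ * ‖n‖ := abs_real_inner_le_norm _ _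
        _ = ‖ξj s - ξa s‖ := by rw [hn, mul_one]
    exact inv_mul_sqrt_le_of_half_le (hq s) (by linarith [hfar s hs])
  · rw [intervalIntegral.integral_const_mul]
    refine mul_le_mul_of_nonneg_left ?_ (by positivity)
    exact integral_ballistic_le h12 hW hA₀ (fun s _ ↦ hxd s) hx'c.continuousOn hspeed

/-! ### The explicit radius for a member set with outsiders -/

/-- `r^{-3/2} ≤ …` in the `rpow` spelling: `(r^{3/2})⁻¹ = (r√r)⁻¹` for `r ≥ 0`. [folklore] -/
theorem inv_rpow_three_halves {r : ℝ} (hr : 0 ≤ r) : (r ^ (3 / 2 : ℝ))⁻¹ = (r * √r)⁻¹ := by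
  rw [rpow_three_halves_eq hr]

/-- `((2/3)D)^{-3/2} ≤ 2·D^{-3/2}` for `D > 0` (`(3/2)^{3/2} < 2`). [folklore] -/
theorem inv_two_thirds_mul_sqrt_le {D : ℝ} (hD : 0 < D) :
    (2 / 3 * D * √(2 / 3 * D))⁻¹ ≤ 2 * (D * √D)⁻¹ := by
  have hsD : 0 < √D := Real.sqrt_pos.mpr hD
  have hs23 : √(2 / 3 * D) = √(2 / 3) * √D := Real.sqrt_mul (by norm_num) D
  rw [hs23]
  -- `√(2/3) ≥ 4/5` so `(2/3)·√(2/3) ≥ 8/15 > 1/2`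
  have hsq : (4 / 5 : ℝ) ≤ √(2 / 3) := by
    rw [show (4 / 5 : ℝ) = √((4 / 5) ^ 2) by rw [Real.sqrt_sq (by norm_num)]]
    exact Real.sqrt_le_sqrt (by norm_num)
  rw [show 2 / 3 * D * (√(2 / 3) * √D) = (2 / 3 * √(2 / 3)) * (D * √D) by ring, mul_inv]
  have hDD : 0 < (D * √D)⁻¹ := by positivity
  have hcoef : (2 / 3 * √(2 / 3))⁻¹ ≤ 2 := by
    rw [inv_le_comm₀ (by positivity) (by norm_num)]
    linarith
  exact mul_le_mul_of_nonneg_right hcoef hDD.le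

set_option maxHeartbeats 400000 in
/-- **THE INTEGRAL OF THE EXPLICIT RADIUS.** For a member set with nonempty complement `Sᶜ`, reference `a`, and the radius
`R(s) = min(c₀s, (2/3)·min_{j∈Sᶜ}‖ξⱼ(s) − ξₐ(s)‖)` on `[t₁,t₂]` (`0 < c₀`, `0 < t₁`, all these distances `≥ A₀ > 0`), if every pair
`(a, j)`, `j ∈ Sᶜ`, is ballistic with floor `W/2`, then `∫_{t₁}^{t₂} R^{-3/2} ≤ 2c₀^{-3/2}t₁^{-1/2} + |Sᶜ|·2·(2√2·8/(W√A₀))`.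
[folklore] -/
theorem integral_radius_le {N : ℕ} (ξ : Fin N → ℝ → E3) (hξ : ∀ i, ContDiff ℝ 1 (ξ i)) (Sc : Finset (Fin N)) (hSc : Sc.Nonempty)
    (a : Fin N) {t₁ t₂ c₀ W A₀ : ℝ} (ht₁ : 0 < t₁) (h12 : t₁ ≤ t₂) (hc₀ : 0 < c₀) (hW : 0 < W) (hA₀ : 0 < A₀)
    (n : Fin N → E3) (hn : ∀ j ∈ Sc, ‖n j‖ = 1)
    (hspeed : ∀ j ∈ Sc, ∀ s ∈ Icc t₁ t₂, W / 2 ≤ ⟪deriv (ξ j) s - deriv (ξ a) s, n j⟫)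
    (hfar : ∀ j ∈ Sc, ∀ s ∈ Icc t₁ t₂, A₀ ≤ ‖ξ j s - ξ a s‖) :
    ∫ s in t₁..t₂, ((min (c₀ * s) (2 / 3 * Sc.inf' hSc fun j ↦ ‖ξ j s - ξ a s‖)) ^ (3 / 2 : ℝ))⁻¹ ≤
      2 * (c₀ ^ (3 / 2 : ℝ))⁻¹ * (t₁ ^ (1 / 2 : ℝ))⁻¹ + Sc.card * (2 * (2 * √2 * (8 / (W * √A₀)))) := by
  classical
  -- the pointwise majorant
  set ψ : Fin N → ℝ → ℝ := fun j s ↦ 2 * √2 * ((|⟪ξ j s - ξ a s, n j⟫| + A₀) * √(|⟪ξ j s - ξ a s, n j⟫| + A₀))⁻¹ with hψ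
  have hball : ∀ j ∈ Sc, (∀ s ∈ Icc t₁ t₂, (‖ξ j s - ξ a s‖ * √‖ξ j s - ξ a s‖)⁻¹ ≤ ψ j s) ∧
      ContinuousOn (ψ j) (Icc t₁ t₂) ∧ ∫ s in t₁..t₂, ψ j s ≤ 2 * √2 * (8 / (W * √A₀)) := fun j hj ↦
    ballistic_majorant_inner (hξ a) (hξ j) (hn j hj) h12 hW hA₀ (hspeed j hj) (hfar j hj)
  have hψ0 : ∀ j s, 0 ≤ ψ j s := fun j s ↦ by positivity
  have hDpos : ∀ s ∈ Icc t₁ t₂, 0 < Sc.inf' hSc fun j ↦ ‖ξ j s - ξ a s‖ := by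
    intro s hs
    obtain ⟨j, hj, hjmin⟩ := Finset.exists_mem_eq_inf' hSc (fun j ↦ ‖ξ j s - ξ a s‖)
    rw [hjmin]; exact hA₀.trans_le (hfar j hj s hs)
  -- pointwise: `R^{-3/2} ≤ (c₀s)^{-3/2} + 2 Σ ψ_j`
  have hpt : ∀ s ∈ Icc t₁ t₂, ((min (c₀ * s) (2 / 3 * Sc.inf' hSc fun j ↦ ‖ξ j s - ξ a s‖)) ^ (3 / 2 : ℝ))⁻¹ ≤
      ((c₀ * s) ^ (3 / 2 : ℝ))⁻¹ + 2 * ∑ j ∈ Sc, ψ j s := by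
    intro s hs
    have hcs : 0 < c₀ * s := mul_pos hc₀ (ht₁.trans_le hs.1)
    have hD := hDpos s hs
    have h23 : 0 < 2 / 3 * Sc.inf' hSc (fun j ↦ ‖ξ j s - ξ a s‖) := by positivity
    have h1 := inv_rpow_min_le hcs h23
    -- the outsider term
    obtain ⟨j₀, hj₀, hjmin⟩ := Finset.exists_mem_eq_inf' hSc (fun j ↦ ‖ξ j s - ξ a s‖)
    have h2 : ((2 / 3 * Sc.inf' hSc (fun j ↦ ‖ξ j s - ξ a s‖)) ^ (3 / 2 : ℝ))⁻¹ ≤ 2 * ∑ j ∈ Sc, ψ j s := by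
      rw [inv_rpow_three_halves h23.le, hjmin]
      have hd0 : 0 < ‖ξ j₀ s - ξ a s‖ := hA₀.trans_le (hfar j₀ hj₀ s hs)
      calc (2 / 3 * ‖ξ j₀ s - ξ a s‖ * √(2 / 3 * ‖ξ j₀ s - ξ a s‖))⁻¹ ≤ 2 * (‖ξ j₀ s - ξ a s‖ * √‖ξ j₀ s - ξ a s‖)⁻¹ :=
            inv_two_thirds_mul_sqrt_le hd0
        _ ≤ 2 * ψ j₀ s := by linarith [(hball j₀ hj₀).1 s hs]
        _ ≤ 2 * ∑ j ∈ Sc, ψ j s := by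
            have := Finset.single_le_sum (fun j _ ↦ hψ0 j s) hj₀
            linarith
    linarith
  -- integrate
  have hLcont : ContinuousOn (fun s ↦ ((min (c₀ * s) (2 / 3 * Sc.inf' hSc fun j ↦ ‖ξ j s - ξ a s‖)) ^ (3 / 2 : ℝ))⁻¹)
      (Icc t₁ t₂) := by
    have hdist : ∀ j, Continuous fun s ↦ ‖ξ j s - ξ a s‖ := fun j ↦
      ((hξ j).continuous.sub (hξ a).continuous).norm
    have hinf : Continuous fun s ↦ Sc.inf' hSc fun j ↦ ‖ξ j s - ξ a s‖ := by
      have h := Continuous.finset_inf' hSc (f := fun j s ↦ ‖ξ j s - ξ a s‖) fun j _ ↦ hdist j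
      convert h using 1
      ext s
      simp [Finset.inf'_apply]
    have hm : Continuous fun s ↦ min (c₀ * s) (2 / 3 * Sc.inf' hSc fun j ↦ ‖ξ j s - ξ a s‖) :=
      (continuous_const.mul continuous_id).min (continuous_const.mul hinf)
    have hmpos : ∀ s ∈ Icc t₁ t₂, 0 < min (c₀ * s) (2 / 3 * Sc.inf' hSc fun j ↦ ‖ξ j s - ξ a s‖) := fun s hs ↦
      lt_min (mul_pos hc₀ (ht₁.trans_le hs.1)) (by have := hDpos s hs; positivity)
    refine (hm.continuousOn.rpow_const fun s hs ↦ Or.inl (hmpos s hs).ne').inv₀ fun s hs ↦ ?_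
    exact (Real.rpow_pos_of_pos (hmpos s hs) _).ne'
  have hR1cont : ContinuousOn (fun s ↦ ((c₀ * s) ^ (3 / 2 : ℝ))⁻¹) (Icc t₁ t₂) := by
    refine ContinuousOn.inv₀ ?_ fun s hs ↦ (Real.rpow_pos_of_pos (mul_pos hc₀ (ht₁.trans_le hs.1)) _).ne'
    exact (continuousOn_const.mul continuousOn_id).rpow_const fun s hs ↦ Or.inl (mul_pos hc₀ (ht₁.trans_le hs.1)).ne'
  have hR2cont : ContinuousOn (fun s ↦ 2 * ∑ j ∈ Sc, ψ j s) (Icc t₁ t₂) :=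
    continuousOn_const.mul (continuousOn_finsetSum _ fun j hj ↦ (hball j hj).2.1)
  have hI1 := integral_inv_rpow_three_halves_mul_le hc₀ ht₁ h12
  have hI2 : ∫ s in t₁..t₂, 2 * ∑ j ∈ Sc, ψ j s ≤ Sc.card * (2 * (2 * √2 * (8 / (W * √A₀)))) := by
    rw [intervalIntegral.integral_const_mul,
      intervalIntegral.integral_finsetSum fun j hj ↦ ((hball j hj).2.1.intervalIntegrable_of_Icc h12)]
    have : ∑ j ∈ Sc, ∫ s in t₁..t₂, ψ j s ≤ ∑ j ∈ Sc, 2 * √2 * (8 / (W * √A₀)) :=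
      Finset.sum_le_sum fun j hj ↦ (hball j hj).2.2
    rw [Finset.sum_const, nsmul_eq_mul] at this
    linarith
  calc ∫ s in t₁..t₂, ((min (c₀ * s) (2 / 3 * Sc.inf' hSc fun j ↦ ‖ξ j s - ξ a s‖)) ^ (3 / 2 : ℝ))⁻¹
      ≤ ∫ s in t₁..t₂, (((c₀ * s) ^ (3 / 2 : ℝ))⁻¹ + 2 * ∑ j ∈ Sc, ψ j s) :=
        intervalIntegral.integral_mono_on h12 (hLcont.intervalIntegrable_of_Icc h12)
          ((hR1cont.add hR2cont).intervalIntegrable_of_Icc h12) hpt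
    _ = (∫ s in t₁..t₂, ((c₀ * s) ^ (3 / 2 : ℝ))⁻¹) + ∫ s in t₁..t₂, 2 * ∑ j ∈ Sc, ψ j s :=
        intervalIntegral.integral_add (hR1cont.intervalIntegrable_of_Icc h12) (hR2cont.intervalIntegrable_of_Icc h12)
    _ ≤ 2 * (c₀ ^ (3 / 2 : ℝ))⁻¹ * (t₁ ^ (1 / 2 : ℝ))⁻¹ + Sc.card * (2 * (2 * √2 * (8 / (W * √A₀)))) := add_le_add hI1 hI2

/-- Registered helper form of `inv_two_thirds_mul_sqrt_le`. [folklore] -/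
theorem oracle_inv_two_thirds_mul_sqrt_le : ∀ (D : ℝ), 0 < D → (2 / 3 * D * √(2 / 3 * D))⁻¹ ≤ 2 * (D * √D)⁻¹ :=
  fun _ hD ↦ inv_two_thirds_mul_sqrt_le hD

end Summit.FinalStateConjecture.FinalStateConjecture.Theorems.SublinearIsFree.Oracle

end
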